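import Summits.CriticalPhenomena.PercolationContinuityZ3.Theorems.PercNearOneGluingAdditiveGluingCovTransferSet
import HarnessLib

/-!
# Crux `PercNearOneGluing.AdditiveGluing` (stmt-CriticalPhenomena-4576): the surplus transfer (S5) for two relays from the Γ-transfer (G1)

Support file (`--supports stmt-CriticalPhenomena-4576`, lead-of-record prim-png-lead-4576 gen 8).  No named facts, no sorries, no definitions.

For relays `a, b` with `m_a ≤ m_b` (`m_c = ∫ F(C(c))`), observers `o, v`, `F` monotone nonnegative: the two-relay surplus splits EXACTLY as
`Sur_x({a,b}) = A_x + Γ_x`, `A_x := ∫_{x↔{a,b}} F(C_a) − μ(x↔{a,b})·m_a` (covariance of the least relay's cluster value with `{x ↔ T}`) and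
`Γ_x := ∫_{x↔b, x↮a} (F(C_b) − F(C_a)) − μ(x↔b, x↮a)·(m_b − m_a)` ("excess of `b` over `a` where `x` holds `b` only").
The A-part transfers by the tree theorem `covTransfer_relaySet` (Harris + two-set BHK).  Hence (`surplusTransfer_pair_of_gammaTransfer`):
   (G1)  `μ({v↮a}∩{v↮b}∩{o↔v})·Γ_v ≤ μ({v↮a}∩{v↮b})·Γ_o`   ⟹   (S5) for `T = {a,b}`,
and with the tree's `gen_triple_of_surplusTransfer_pair`: (G1) ⟹ (GEN) for three relays (`gen_triple_of_gammaTransfer`).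
(G1) is census-clean (lead memo LeadMath-g8 §7–§8; 0 violations, all monotone `F` by LP) and is implied, via the Markov property of the cluster of `b`,
by the single-cluster CONDITIONED COVARIANCE TRANSFER (CCT) `Cov(G(C_b),1_{o∈C_b} | b↮a) ≥ μ(o↔v | v↮a, v↮b)·Cov(G(C_b),1_{v∈C_b} | b↮a)` (open).
[cite: VandenbergHaggstromKahn2005, Thm. 1.5 (p. 7)] [cite: KozmaNitzan2024, Conj. 4 (p. 32)]
-/

noncomputable section

namespace Summit.CriticalPhenomena.PercolationContinuityZ3.Theorems.AGloc

open MeasureTheory Set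
open Literature.Probability.LatticeModels (prodBernoulli)
open Literature.Probability.Percolation Literature.Probability.Percolation.KNPreFKG

variable {V : Type*} [Fintype V] [DecidableEq V]

/-- **(G1) ⟹ (S5)₂.**  The surplus-transfer inequality for the relay pair `{a, b}` (`m_a ≤ m_b`) from the Γ-transfer hypothesis; the split
`Sur = A + Γ` is exact and the A-part is `covTransfer_relaySet`. [cite: VandenbergHaggstromKahn2005, Thm. 1.5 (p. 7)] -/
theorem surplusTransfer_pair_of_gammaTransfer (w : Sym2 V → unitInterval) (o v a b : V) (F : Set V → ℝ)
    (hF : ∀ S S' : Set V, S ⊆ S' → F S ≤ F S') (hF0 : ∀ S, 0 ≤ F S)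
    (hG1 : (prodBernoulli w).real ({ω : BondConfig V | ¬ (openGraph ω).Reachable v a} ∩ {ω | ¬ (openGraph ω).Reachable v b} ∩ openConn o v) *
        (∫ ω in (openConn v b ∩ (openConn v a)ᶜ : Set (BondConfig V)), (F (openCluster ω b) - F (openCluster ω a)) ∂(prodBernoulli w) -
          (prodBernoulli w).real (openConn v b ∩ (openConn v a)ᶜ : Set (BondConfig V)) *
            (∫ ω, F (openCluster ω b) ∂(prodBernoulli w) - ∫ ω, F (openCluster ω a) ∂(prodBernoulli w))) ≤
      (prodBernoulli w).real ({ω : BondConfig V | ¬ (openGraph ω).Reachable v a} ∩ {ω | ¬ (openGraph ω).Reachable v b}) *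
        (∫ ω in (openConn o b ∩ (openConn o a)ᶜ : Set (BondConfig V)), (F (openCluster ω b) - F (openCluster ω a)) ∂(prodBernoulli w) -
          (prodBernoulli w).real (openConn o b ∩ (openConn o a)ᶜ : Set (BondConfig V)) *
            (∫ ω, F (openCluster ω b) ∂(prodBernoulli w) - ∫ ω, F (openCluster ω a) ∂(prodBernoulli w)))) :
    (prodBernoulli w).real ({ω : BondConfig V | ¬ (openGraph ω).Reachable v a} ∩ {ω | ¬ (openGraph ω).Reachable v b} ∩ openConn o v) *
        (∫ ω in (openConn v a ∪ openConn v b), F (openCluster ω v) ∂(prodBernoulli w) -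
          ((prodBernoulli w).real (openConn v a) * ∫ ω, F (openCluster ω a) ∂(prodBernoulli w) +
            (prodBernoulli w).real (openConn v b ∩ (openConn v a)ᶜ : Set (BondConfig V)) * ∫ ω, F (openCluster ω b) ∂(prodBernoulli w))) ≤
      (prodBernoulli w).real ({ω : BondConfig V | ¬ (openGraph ω).Reachable v a} ∩ {ω | ¬ (openGraph ω).Reachable v b}) *
        (∫ ω in (openConn o a ∪ openConn o b), F (openCluster ω o) ∂(prodBernoulli w) -
          ((prodBernoulli w).real (openConn o a) * ∫ ω, F (openCluster ω a) ∂(prodBernoulli w) +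
            (prodBernoulli w).real (openConn o b ∩ (openConn o a)ᶜ : Set (BondConfig V)) * ∫ ω, F (openCluster ω b) ∂(prodBernoulli w))) := by
  classical
  set μ := prodBernoulli w with hμ
  set fa : BondConfig V → ℝ := fun ω => F (openCluster ω a) with hfa
  set fb : BondConfig V → ℝ := fun ω => F (openCluster ω b) with hfb
  set ma : ℝ := ∫ ω, fa ω ∂μ with hma
  set mb : ℝ := ∫ ω, fb ω ∂μ with hmb
  have hmeas : ∀ S : Set (BondConfig V), MeasurableSet S := fun _ => MeasurableSet.of_discrete
  have hint : ∀ (k : BondConfig V → ℝ) (S : Set (BondConfig V)), IntegrableOn k S μ :=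
    fun k S => (Integrable.of_finite).integrableOn
  -- the A-part: `covTransfer_relaySet` with `T = {a, b}` and relay `a`
  have hA := covTransfer_relaySet w ({a, b} : Finset V) o v a (by simp) F hF hF0
  have hUx : ∀ x : V, (⋃ t ∈ ({a, b} : Finset V), (openConn x t : Set (BondConfig V))) = openConn x a ∪ openConn x b := by
    intro x; ext ω; simp
  have hDx : {ω : BondConfig V | ∀ t ∈ ({a, b} : Finset V), ¬ (openGraph ω).Reachable v t} =
      {ω : BondConfig V | ¬ (openGraph ω).Reachable v a} ∩ {ω | ¬ (openGraph ω).Reachable v b} := by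
    ext ω; simp
  rw [hUx, hUx, hDx] at hA
  change μ.real (({ω : BondConfig V | ¬ (openGraph ω).Reachable v a} ∩ {ω | ¬ (openGraph ω).Reachable v b}) ∩ openConn o v) *
      (∫ ω in openConn v a ∪ openConn v b, fa ω ∂μ - μ.real (openConn v a ∪ openConn v b) * ma) ≤
    μ.real ({ω : BondConfig V | ¬ (openGraph ω).Reachable v a} ∩ {ω | ¬ (openGraph ω).Reachable v b}) *
      (∫ ω in openConn o a ∪ openConn o b, fa ω ∂μ - μ.real (openConn o a ∪ openConn o b) * ma) at hA
  -- the exact split `Sur_x = A_x + Γ_x`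
  have hsplit : ∀ x : V,
      ∫ ω in (openConn x a ∪ openConn x b), F (openCluster ω x) ∂μ -
          (μ.real (openConn x a) * ma + μ.real (openConn x b ∩ (openConn x a)ᶜ : Set (BondConfig V)) * mb) =
        (∫ ω in openConn x a ∪ openConn x b, fa ω ∂μ - μ.real (openConn x a ∪ openConn x b) * ma) +
          (∫ ω in (openConn x b ∩ (openConn x a)ᶜ : Set (BondConfig V)), (fb ω - fa ω) ∂μ -
            μ.real (openConn x b ∩ (openConn x a)ᶜ : Set (BondConfig V)) * (mb - ma)) := by
    intro x
    set Oa : Set (BondConfig V) := openConn x a with hOa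
    set Ob : Set (BondConfig V) := openConn x b with hOb
    have hd : (Oa ∪ Ob) \ Oa = Ob ∩ Oaᶜ := by
      ext ω; simp only [mem_sdiff, mem_union, mem_inter_iff, mem_compl_iff]; tauto
    have hUμ : μ.real (Oa ∪ Ob) = μ.real Oa + μ.real (Ob ∩ Oaᶜ) := by
      rw [← measureReal_inter_add_sdiff (s := Oa ∪ Ob) (h := measure_ne_top _ _) (hmeas Oa), inter_eq_right.2 subset_union_left, hd]
    have hx : ∫ ω in Oa ∪ Ob, F (openCluster ω x) ∂μ = ∫ ω in Oa, fa ω ∂μ + ∫ ω in Ob ∩ Oaᶜ, fb ω ∂μ := by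
      rw [← integral_inter_add_sdiff (hmeas Oa) (hint _ (Oa ∪ Ob)), inter_eq_right.2 subset_union_left, hd,
        setIntegral_congr_fun (hmeas Oa) (fun ω hω => by
          show F (openCluster ω x) = fa ω
          simp only [hfa]; rw [openCluster_eq_of_reachable (hω : (openGraph ω).Reachable x a)]),
        setIntegral_congr_fun (hmeas (Ob ∩ Oaᶜ)) (fun ω hω => by
          show F (openCluster ω x) = fb ω
          simp only [hfb]; rw [openCluster_eq_of_reachable (hω.1 : (openGraph ω).Reachable x b)])]
    have ha : ∫ ω in Oa ∪ Ob, fa ω ∂μ = ∫ ω in Oa, fa ω ∂μ + ∫ ω in Ob ∩ Oaᶜ, fa ω ∂μ := by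
      rw [← integral_inter_add_sdiff (hmeas Oa) (hint fa (Oa ∪ Ob)), inter_eq_right.2 subset_union_left, hd]
    have hsub : ∫ ω in Ob ∩ Oaᶜ, (fb ω - fa ω) ∂μ = ∫ ω in Ob ∩ Oaᶜ, fb ω ∂μ - ∫ ω in Ob ∩ Oaᶜ, fa ω ∂μ :=
      integral_sub (hint fb _) (hint fa _)
    rw [hx, ha, hsub, hUμ]
    ring
  rw [hsplit o, hsplit v, mul_add, mul_add]
  exact add_le_add hA hG1

/-- **(G1) ⟹ (GEN) for three relays**: composition of `surplusTransfer_pair_of_gammaTransfer` with the tree's `gen_triple_of_surplusTransfer_pair`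
(`a₁ = a`, `a₂ = b` the two least relays, `a₃ = v` the most reliable one). [cite: KozmaNitzan2024, Conj. 4 (p. 32)] -/
theorem gen_triple_of_gammaTransfer (w : Sym2 V → unitInterval) (o a b c : V) (hca : c ≠ a) (hcb : c ≠ b)
    (F : Set V → ℝ) (hF : ∀ S S' : Set V, S ⊆ S' → F S ≤ F S') (hF0 : ∀ S, 0 ≤ F S)
    (hm12 : ∫ ω, F (openCluster ω a) ∂(prodBernoulli w) ≤ ∫ ω, F (openCluster ω b) ∂(prodBernoulli w))
    (hm23 : ∫ ω, F (openCluster ω b) ∂(prodBernoulli w) ≤ ∫ ω, F (openCluster ω c) ∂(prodBernoulli w))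
    (hG1 : (prodBernoulli w).real ({ω : BondConfig V | ¬ (openGraph ω).Reachable c a} ∩ {ω | ¬ (openGraph ω).Reachable c b} ∩ openConn o c) *
        (∫ ω in (openConn c b ∩ (openConn c a)ᶜ : Set (BondConfig V)), (F (openCluster ω b) - F (openCluster ω a)) ∂(prodBernoulli w) -
          (prodBernoulli w).real (openConn c b ∩ (openConn c a)ᶜ : Set (BondConfig V)) *
            (∫ ω, F (openCluster ω b) ∂(prodBernoulli w) - ∫ ω, F (openCluster ω a) ∂(prodBernoulli w))) ≤
      (prodBernoulli w).real ({ω : BondConfig V | ¬ (openGraph ω).Reachable c a} ∩ {ω | ¬ (openGraph ω).Reachable c b}) *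
        (∫ ω in (openConn o b ∩ (openConn o a)ᶜ : Set (BondConfig V)), (F (openCluster ω b) - F (openCluster ω a)) ∂(prodBernoulli w) -
          (prodBernoulli w).real (openConn o b ∩ (openConn o a)ᶜ : Set (BondConfig V)) *
            (∫ ω, F (openCluster ω b) ∂(prodBernoulli w) - ∫ ω, F (openCluster ω a) ∂(prodBernoulli w)))) :
    (prodBernoulli w).real (openConn o a) * ∫ ω, F (openCluster ω a) ∂(prodBernoulli w) +
        (prodBernoulli w).real (openConn o b ∩ (openConn o a)ᶜ : Set (BondConfig V)) * ∫ ω, F (openCluster ω b) ∂(prodBernoulli w) +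
        (prodBernoulli w).real (openConn o c ∩ (openConn o a ∪ openConn o b)ᶜ : Set (BondConfig V)) *
          ∫ ω, F (openCluster ω c) ∂(prodBernoulli w) ≤
      ∫ ω in (openConn o a ∪ openConn o b ∪ openConn o c), F (openCluster ω o) ∂(prodBernoulli w) :=
  gen_triple_of_surplusTransfer_pair w o a b c hca hcb F hF hF0 hm12 hm23
    (surplusTransfer_pair_of_gammaTransfer w o c a b F hF hF0 hG1)

end Summit.CriticalPhenomena.PercolationContinuityZ3.Theorems.AGloc

end
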